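import Mathlib
import Summits.KontsevichZagierPeriods.Zeta5Search.RecordCellDClassDataProof
import Summits.KontsevichZagierPeriods.Zeta5Search.UniversalDigit
import HarnessLib

/-!
# ζ(5) search — the CLASS-STRUCTURE LEMMA of cell A and gen-2 g9's `RecordCellClassData` / `RecordCellBonus` BY NAME

Cell `pub-zeta5` (HONEST FRAMING: systematic search; no irrationality claim unless certified), P1 prover seat
generation 6.  gen-2 g9 typed the class structure of the record cell A (`14n < p < 15n` on `b(n) = n·(41;17,…,11)`) as
`ClusterValuation.RecordCellClassData` (REPORT-gen2-g9 §2.2, proved there on paper for all `n`) and the Lemma-D bonus as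
`RecordCellBonus`.  Both are THEOREMS here, read off P1 g5's atlas `RecordCellAAtlas{,NotMin}` (minimal classes `MinA ∪ MinS ∪ MinAbar`:
bare two-point classes, two poles, `E = −4`, centre-free; every other class `ν ≥ −3`; witness `x = 14n ∈ MinAbar`), the value
**`casLB (bRec n) p = −5`** (`VB = −4`, `rowMin = −1`), and `CellA.recordCellA` (`v_p(Cas₇) ≥ −4 = casLB + 1`).  Exact arithmetic;
nothing about irrationality.
-/

open Finset

namespace Summit.KontsevichZagierPeriods.Zeta5Search.CellA

open Summit.KontsevichZagierPeriods.Zeta5Search.CasoratianValuation (InPolytope shift casoratian)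
open Summit.KontsevichZagierPeriods.Zeta5Search.ClusterValuation
open Summit.KontsevichZagierPeriods.Zeta5Search.LevelClass
open Summit.KontsevichZagierPeriods.Zeta5Search.CellD (classPoleCount_level)

/-! ### §1 The three two-point types and the minimal classes -/

/-- Type `(−1,−3)`. -/
def eA13 : ℕ → ℤ
  | 0 => -1 | 1 => -3 | _ => 0
/-- Type `(−2,−2)`. -/
def eA22 : ℕ → ℤ
  | 0 => -2 | 1 => -2 | _ => 0
/-- Type `(−3,−1)`. -/
def eA31 : ℕ → ℤ
  | 0 => -3 | 1 => -1 | _ => 0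

/-- Two point values as a level exponent vector. -/
theorem he_of_two {b : ℕ → ℤ} {x p : ℕ} {e : ℕ → ℤ} (h0 : netExp b x = e 0) (h1 : netExp b (x + p) = e 1) :
    ∀ k ≤ 1, netExp b (x + k * p) = e k := by
  intro k hk
  interval_cases k
  · simpa using h0
  · simpa using h1

section MinData

variable {n p : ℕ} (hn : 1 ≤ n) (hp14 : 14 * n < p) (hp15 : p < 15 * n) (hprime : p.Prime)

include hp14 hp15 in
/-- **Centre-freeness** on cell A: a class `x < p` with `2x + p ≠ 41n` and `2x + 2p ≠ 41n` does not contain the centre residue. -/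
theorem not_centreInA {x : ℕ} (hx : x < p) (h1 : 2 * x + p ≠ 41 * n) (h2 : 2 * x + 2 * p ≠ 41 * n) :
    ¬ CentreIn (bRec n) p x := by
  rintro ⟨k, hk⟩
  rw [bRec_zero] at hk
  have hk1 : -3 < k := by
    by_contra hle
    push Not at hle
    have : (p : ℤ) * k ≤ (p : ℤ) * (-3) := mul_le_mul_of_nonneg_left hle (by omega)
    omega
  have hk2 : k < 0 := by
    by_contra hge
    push Not at hge
    have : (p : ℤ) * 0 ≤ (p : ℤ) * k := mul_le_mul_of_nonneg_left hge (by omega)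
    omega
  interval_cases k <;> omega

include hn hp14 hp15 hprime in
/-- A minimal class of cell A (`MinA ∪ MinS ∪ MinAbar`): two poles, class exponent `−4`, centre-free, class `{x, x+p}`. -/
theorem data_minAll {x : ℕ} (hx : x ∈ MinAll n p) :
    classPoleCount (bRec n) p x = 2 ∧ classExp (bRec n) p x = -4 ∧ ¬ CentreIn (bRec n) p x ∧
      classSet (bRec n) p x = {x, x + p} ∧ 12 * n ≤ x ∧ x + p ≤ 29 * n := by
  haveI : Fact p.Prime := ⟨hprime⟩
  rw [MinAll, mem_union, mem_union] at hx
  have key : ∀ (e : ℕ → ℤ), typeExp 1 e = -4 → ((range 2).filter fun k => e k < 0).card = 2 →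
      netExp (bRec n) x = e 0 → netExp (bRec n) (x + p) = e 1 → x < p → x + p ≤ 41 * n → 41 * n < x + 2 * p →
      2 * x + p ≠ 41 * n → 12 * n ≤ x → x + p ≤ 29 * n →
      classPoleCount (bRec n) p x = 2 ∧ classExp (bRec n) p x = -4 ∧ ¬ CentreIn (bRec n) p x ∧
        classSet (bRec n) p x = {x, x + p} ∧ 12 * n ≤ x ∧ x + p ≤ 29 * n := by
    intro e hE hcard e0 e1 hxp h1 h2 hs h12 h29
    have hL : x + 1 * p ≤ (bRec n 0).toNat := by rw [bRec_zero_toNat]; omega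
    have hL' : (bRec n 0).toNat < x + 1 * p + p := by rw [bRec_zero_toNat]; omega
    have hc := not_centreInA hp14 hp15 hxp hs (by omega)
    have he := he_of_two (e := e) e0 e1
    refine ⟨by rw [classPoleCount_level (bRec n) hxp hL hL' e he, hcard],
      by rw [classExp_level (bRec n) hxp hL hL' e he hc, hE], hc, ?_, h12, h29⟩
    rw [classSet_bRec hp14 hp15 hxp, if_neg (by omega)]
  rcases hx with (h | h) | h
  · obtain ⟨e0, e1, -, -, hxp, h1, h2⟩ := netExp_minA hn hp14 hp15 h
    have := mem_minA.1 h
    exact key eA13 (by decide) (by decide) e0 e1 hxp h1 h2 (by omega) (by omega) (by omega)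
  · obtain ⟨e0, e1, -, -, hxp, h1, h2⟩ := netExp_minS hn hp14 hp15 h
    have := mem_minS.1 h
    exact key eA22 (by decide) (by decide) e0 e1 hxp h1 h2 this.2.2.2 (by omega) (by omega)
  · have h' := conj_mem_minA hp14 h
    obtain ⟨e0, e1, -, -, -, -, -⟩ := netExp_minA hn hp14 hp15 h'
    have hb := mem_minAbar.1 h
    -- the conjugate data give the exponents of `x` via reflection-free direct evaluation
    have f0 : netExp (bRec n) x = -3 := by
      rw [netExp_bRec_of_ne n x (by omega), dep7_lower (by norm_num : 4 ≤ 7) (by omega) (by omega)]; norm_num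
    have f1 : netExp (bRec n) (x + p) = -1 := by
      rw [netExp_bRec_of_ne n (x + p) (by omega), dep7_upper (by norm_num : 2 ≤ 7) (by omega) (by omega)]; norm_num
    exact key eA31 (by decide) (by decide) f0 f1 hb.1 (by omega) (by omega) (by omega) (by omega) hb.2.2

include hn hp14 hp15 hprime in
/-- Off the minimal classes `ν ≥ −3`; for multipole classes this is `E ≥ −3`. -/
theorem notMin_bounds {x : ℕ} (hx : x < p) (hm : x ∉ MinAll n p) :
    -3 ≤ classNu (bRec n) p x ∧ (2 ≤ classPoleCount (bRec n) p x → -3 ≤ classExp (bRec n) p x) := by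
  rw [MinAll, mem_union, mem_union, not_or, not_or] at hm
  have hodd : ¬ 2 ∣ p := fun h => by
    have := (Nat.prime_dvd_prime_iff_eq Nat.prime_two hprime).1 h; omega
  have hν := classNu_ge_of_notMin hn hp14 hp15 hx hodd hm.1.1 hm.1.2 hm.2
  refine ⟨hν, fun h2 => ?_⟩
  have : classNu (bRec n) p x = classExp (bRec n) p x := by unfold classNu; rw [if_neg (by omega)]
  rwa [this] at hν

include hp14 hp15 in
/-- The witness (C5w): `x = 14n ∈ MinAbar`. -/
theorem witness_mem_minAbar : 14 * n ∈ MinAbar n p := by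
  rw [mem_minAbar]; omega

end MinData

/-! ### §2 `casLB = −5` on the cell -/

/-- **`casLB (bRec n) p = −5`** for `14n < p < 15n` (`n ≥ 1`): `VB = −4`, `rowMin = −1`. -/
theorem casLB_bRecA {n p : ℕ} (hn : 1 ≤ n) (hp14 : 14 * n < p) (hp15 : p < 15 * n) (hprime : p.Prime) :
    casLB (bRec n) p = -5 := by
  set x₀ := 14 * n with hx₀
  have hx₀m : x₀ ∈ MinAll n p := by
    rw [MinAll, mem_union]; exact Or.inr (witness_mem_minAbar hp14 hp15)
  have hx₀p : x₀ < p := by omega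
  obtain ⟨hcnt, hE, -⟩ := data_minAll hn hp14 hp15 hprime hx₀m
  have hpole : 1 ≤ classPoleCount (bRec n) p x₀ := by omega
  obtain ⟨v, hv⟩ := vbMin_isSome (bRec n) hx₀p hpole
  obtain ⟨r, hr⟩ := rowMin_isSome (bRec n) hx₀p hpole
  have hLB : casLB (bRec n) p = v + r := by simp [casLB, hv, hr]
  have hν₀ : classNu (bRec n) p x₀ = -4 := by
    unfold classNu; rw [if_neg (by omega), hE]
  have hv1 : v ≤ -4 := by have := vbMin_le (bRec n) hv hx₀p hpole; rwa [hν₀] at this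
  have hr1 : r ≤ -1 := by have := rowMin_le_multi (bRec n) hr hx₀p (by omega); rwa [hE] at this
  have hνall : ∀ y, y < p → -4 ≤ classNu (bRec n) p y ∧ (2 ≤ classPoleCount (bRec n) p y → -4 ≤ classExp (bRec n) p y) := by
    intro y hy
    by_cases hm : y ∈ MinAll n p
    · obtain ⟨-, hEy, -⟩ := data_minAll hn hp14 hp15 hprime hm
      exact ⟨by rw [← hEy]; exact classExp_le_classNu _ _ _, fun _ => by rw [hEy]⟩
    · obtain ⟨h1, h2⟩ := notMin_bounds hn hp14 hp15 hprime hy hm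
      exact ⟨by omega, fun h => by have := h2 h; omega⟩
  have hv2 : -4 ≤ v := by
    obtain ⟨hmem, -⟩ := List.min?_eq_some_iff.1 hv
    obtain ⟨y, hy, rfl⟩ := List.mem_map.1 hmem
    obtain ⟨hyp, -⟩ := List.mem_filter.1 hy
    rw [List.mem_range] at hyp
    exact (hνall y hyp).1
  have hr2 : -1 ≤ r := by
    obtain ⟨hmem, -⟩ := List.min?_eq_some_iff.1 hr
    rcases List.mem_append.1 hmem with h | h
    · obtain ⟨y, hy, hz⟩ := List.mem_filterMap.1 h
      rw [List.mem_range] at hy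
      by_cases hc1 : classPoleCount (bRec n) p y = 1
      · rw [if_pos hc1] at hz; simp at hz; omega
      · rw [if_neg hc1] at hz
        by_cases hc2 : 2 ≤ classPoleCount (bRec n) p y
        · rw [if_pos hc2] at hz
          simp at hz
          have := (hνall y hy).2 hc2
          omega
        · rw [if_neg hc2] at hz; simp at hz
    · split_ifs at h with hd
      · simp at h; omega
      · simp at h
  omega

/-! ### §3 gen-2 g9's two statements, by name -/

/-- **`ClusterValuation.RecordCellClassData` (gen-2 g9, REPORT §2.2) is a THEOREM.** -/
theorem recordCellClassData_holds : RecordCellClassData := by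
  intro n p hn2 hprime hp14 hp15
  have hn : 1 ≤ n := by omega
  have hmult : ∀ x, x ∈ multipoleClasses (bRec n) p ↔ x < p ∧ 2 ≤ classPoleCount (bRec n) p x := fun x => by
    rw [multipoleClasses, mem_filter, mem_range]
  refine ⟨casLB_bRecA hn hp14 hp15 hprime, ⟨14 * n, ?_, ?_⟩, fun x hx => ?_, fun y hy hc1 => ?_, fun x hx hE => ?_⟩
  · have hm : 14 * n ∈ MinAll n p := by rw [MinAll, mem_union]; exact Or.inr (witness_mem_minAbar hp14 hp15)
    rw [hmult]
    exact ⟨by omega, by have := (data_minAll hn hp14 hp15 hprime hm).1; omega⟩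
  · have hm : 14 * n ∈ MinAll n p := by rw [MinAll, mem_union]; exact Or.inr (witness_mem_minAbar hp14 hp15)
    exact (data_minAll hn hp14 hp15 hprime hm).2.1
  · obtain ⟨hxp, h2⟩ := (hmult x).1 hx
    by_cases hm : x ∈ MinAll n p
    · rw [(data_minAll hn hp14 hp15 hprime hm).2.1]
    · have := (notMin_bounds hn hp14 hp15 hprime hxp hm).2 h2; omega
  · have hm : y ∉ MinAll n p := fun hm => by have := (data_minAll hn hp14 hp15 hprime hm).1; omega
    exact (notMin_bounds hn hp14 hp15 hprime hy hm).1
  · obtain ⟨hxp, h2⟩ := (hmult x).1 hx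
    have hm : x ∈ MinAll n p := by
      by_contra hm; have := (notMin_bounds hn hp14 hp15 hprime hxp hm).2 h2; omega
    obtain ⟨-, -, hc, hcs, h12, h29⟩ := data_minAll hn hp14 hp15 hprime hm
    refine ⟨hc, hcs, by omega, by omega, ?_⟩
    rw [MinAll, mem_union, mem_union] at hm
    rcases hm with (h | h) | h
    · obtain ⟨e0, e1, -⟩ := netExp_minA hn hp14 hp15 h
      exact Or.inl ⟨e0, e1⟩
    · obtain ⟨e0, e1, -⟩ := netExp_minS hn hp14 hp15 h
      exact Or.inr (Or.inl ⟨e0, e1⟩)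
    · have hb := mem_minAbar.1 h
      have f0 : netExp (bRec n) x = -3 := by
        rw [netExp_bRec_of_ne n x (by omega), dep7_lower (by norm_num : 4 ≤ 7) (by omega) (by omega)]; norm_num
      have f1 : netExp (bRec n) (x + p) = -1 := by
        rw [netExp_bRec_of_ne n (x + p) (by omega), dep7_upper (by norm_num : 2 ≤ 7) (by omega) (by omega)]; norm_num
      exact Or.inr (Or.inr ⟨f0, f1⟩)

/-- **`ClusterValuation.RecordCellBonus` (gen-2 g9) is a THEOREM**: `casLB + 1 = −4 ≤ v_p(Cas₇(b(n)))` on the cell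
(`casLB_bRecA` + P1 g5's `recordCellA`). -/
theorem recordCellBonus_holds : RecordCellBonus := by
  intro n p hn2 hprime hp14 hp15 hne
  rw [casLB_bRecA (by omega) hp14 hp15 hprime]
  have := recordCellA n p hn2 hprime hp14 hp15 hne
  push_cast
  linarith

end Summit.KontsevichZagierPeriods.Zeta5Search.CellA
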